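import Summits.NavierStokesRegularity.OSWSelfSimilar.SheetRCertificateCoercivity
import Literature.Analysis.OperatorTheory.FiniteRankTwoNormInverse
import HarnessLib

/-!
# SHEET-ℝ frame, MODEL ASSEMBLY layer 4e: the (C2)/(C3) inverse from the ROW LITERALS `KNw`, `epsN` — Woodbury on the `N` local solves
# plus the Neumann step, and the end-to-end MODEL statement keyed on the printed constants

HONEST FRAMING (cell ns-blowup GROUP B / zone Z3, case Z3-SR-CERT; 1-D MODEL certificate (viscous gCLM/OSW sheet on the line at
`(a, c_l, ε) = (1/5, 1/2, 1)`); computer-assisted; not Euler/NS; «violates: none — MODEL»).  Layers 4b–4d take the (C2)/(C3) inverse `M` of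
`1 − S₀∘P` with the DERIVED constant `K_w = KNw/(1 − KNw·epsN)` as a hypothesis.  This file derives `M` — two-sided — from the certificate's
own finite-rank data and the two ROW LITERALS of `CertificateViscousSheetR` (PRICE-impl1 §2, (C2)+(C3)):

* the finite-rank approximation `Π_N u = ∑ᵢ ℓᵢ(u) fᵢ` of `P` (`fᵢ ∈ L²_w` — the Cayley frame —, `ℓᵢ ∈ E*`), a two-sided inverse `N` of the
  capacitance matrix `1 − (ℓⱼ(S₀ fᵢ))` of the `N` forward local solves `S₀ fᵢ`, the bound `‖T_N (S₀ g)‖_E ≤ KNw‖g‖_w` for the Woodbury inverse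
  `T_N = capInverse (S₀∘f) ℓ N` of `1 − S₀∘Π_N`, and the high-pass remainder bound `‖P u − Π_N u‖_w ≤ epsN‖u‖_E` ((E5) × the certified frame
  constants); the kernel fact `KNw·epsN < 1` (`CertificateViscousSheetR.KNw_mul_epsN_lt_one`) closes the Neumann step:
  **`exists_inverse_of_woodbury`** (`Literature.Analysis.OperatorTheory.exists_twoSided_inverse_one_sub_comp`).
* **`modelBlowup_of_woodbury_certificate`** — the end-to-end MODEL statement whose numeric hypotheses are, by name: the pointwise (C1)
  datum, the capacitance inverse `N` with the `KNw` bound, the `epsN` remainder bound, the residual bound `eta`, and `|Ω̄(X₀)| > (√2/8)·rE`: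
  exactly one `δ` in the `rE`-ball solves the linearised weak equation; `Ω* = Ω̄ + prim (der δ)` is `C²` and its exact self-similar viscous
  gCLM solution blows up at every `T > 0`.
No definition, no named fact.  WHAT THIS IS NOT: not NS; the listed numeric hypotheses ARE implementation 1's interval arithmetic (and
implementation 2's, with its own literals) and are not proved here.
-/

noncomputable section

namespace Summit.NavierStokesRegularity.OSWSelfSimilar
namespace SheetRCertificateWoodbury

open _root_.MeasureTheory _root_.Set _root_.Filter _root_.Real _root_.Metric _root_.Function Matrix Finset Literature.Analysis.Fourier
  Literature.Analysis.FluidPDE Literature.Analysis.OperatorTheory SheetRWeakProfilePV SheetRWeakToStrong SheetREnergyClass SheetRWeightedMeasure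
  SheetREnergySpace SheetRLinearisedTests SheetRSolutionOperator SheetRAssemblyOperators SheetRCertificateAssembly SheetRCertificateWeakZero
  SheetRCertificateCoercivity CertificateViscousSheetR
open scoped Topology ENNReal ContDiff BigOperators

variable {Ω Ω₁ : ℝ → ℝ} {H₀ : ℝ} (hc : IsCentre 8 Ω Ω₁ H₀) (hΩ₁ : ContDiff ℝ 1 Ω₁)
  (hC1 : ∀ ξ, ((8:ℝ) ^ 2 + ξ ^ 2) / 2 + 1 + ξ ^ 2 / 2 + 1 / 5 * ξ * (∫ s in (0 : ℝ)..ξ, hilbertTransform Ω s)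
    + (1 / 5) / 2 * ((8:ℝ) ^ 2 + ξ ^ 2) * hilbertTransform Ω ξ ≤ ((8:ℝ) ^ 2 + ξ ^ 2) * potential 8 4 Ω ξ)
  (S₀ : W 8 →L[ℝ] Esp 8 eight_pos)
  (hS₀ : ∀ (g : W 8) (v v₁ : ℝ → ℝ), IsCompactTest v v₁ →
    linForm 8 (drift (1 / 5) Ω) (potential 8 4 Ω) (prim (der (S₀ g))) (der (S₀ g)) v v₁ = ∫ y, ((8:ℝ) ^ 2 + y ^ 2) * ((g : ℝ → ℝ) y * v y))
  {n : ℕ} (f : Fin n → W 8) (ℓ : Fin n → Esp 8 eight_pos →L[ℝ] ℝ) (Nmat : Matrix (Fin n) (Fin n) ℝ)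
  (hN₁ : (1 - capMatrix (fun i => S₀ (f i)) ℓ) * Nmat = 1) (hN₂ : Nmat * (1 - capMatrix (fun i => S₀ (f i)) ℓ) = 1)
  (hKNw : ∀ g : W 8, ‖capInverse (fun i => S₀ (f i)) ℓ Nmat (S₀ g)‖ ≤ (KNw : ℝ) * ‖g‖)
  (hepsN : ∀ u : Esp 8 eight_pos, ‖PopC eight_pos 4 (1 / 5) hc u - ∑ i, ℓ i u • f i‖ ≤ (epsN : ℝ) * ‖u‖)
  (hG : Integrable fun y => ((8:ℝ) ^ 2 + y ^ 2) * (Ω y + 1 / 2 * y * Ω₁ y + 1 / 5 * (∫ s in (0 : ℝ)..y, hilbertTransform Ω s) * Ω₁ y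
    - hilbertTransform Ω y * Ω y - deriv Ω₁ y) ^ 2)
  (hη : Real.sqrt (∫ y, ((8:ℝ) ^ 2 + y ^ 2) * (Ω y + 1 / 2 * y * Ω₁ y + 1 / 5 * (∫ s in (0 : ℝ)..y, hilbertTransform Ω s) * Ω₁ y
    - hilbertTransform Ω y * Ω y - deriv Ω₁ y) ^ 2) ≤ (eta : ℝ))

include hN₁ hN₂ hKNw hepsN in
/-- **The (C2)/(C3) inverse from the row literals.**  From a two-sided inverse `N` of the capacitance matrix of the local solves, the Woodbury
bound `‖T_N (S₀ g)‖_E ≤ KNw‖g‖_w`, the remainder bound `‖P u − Π_N u‖_w ≤ epsN‖u‖_E`, and the kernel fact `KNw·epsN < 1`: a TWO-SIDED inverse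
`M` of `1 − S₀∘P` on the energy space with `‖M (S₀ g)‖_E ≤ (KNw/(1 − KNw·epsN))‖g‖_w` — the hypotheses `hM₁`, `hM₂`, `hK` of layers 4b–4d.
[folklore] -/
theorem exists_inverse_of_woodbury :
    ∃ M : Esp 8 eight_pos →L[ℝ] Esp 8 eight_pos,
      (∀ x, M x - S₀ (PopC eight_pos 4 (1 / 5) hc (M x)) = x) ∧ (∀ x, M (x - S₀ (PopC eight_pos 4 (1 / 5) hc x)) = x) ∧
      ∀ g, ‖M (S₀ g)‖ ≤ ((KNw / (1 - KNw * epsN) : ℚ) : ℝ) * ‖g‖ := by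
  haveI : CompleteSpace (Esp 8 eight_pos) := completeSpace_Esp eight_pos
  obtain ⟨-, -, -, hε0, hK0⟩ := K_pos_and_Llip_pos
  have h1 : (KNw : ℝ) * (epsN : ℝ) < 1 := by have h := KNw_mul_epsN_lt_one; exact_mod_cast h
  obtain ⟨M, hM₁, hM₂, hK⟩ := exists_twoSided_inverse_one_sub_comp S₀ (PopC eight_pos 4 (1 / 5) hc) f ℓ Nmat hN₁ hN₂
    (by exact_mod_cast hK0) (by exact_mod_cast hε0) hKNw hepsN h1
  refine ⟨M, hM₁, hM₂, fun g => ?_⟩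
  rw [Kw_eq]
  exact hK g

include hc hΩ₁ hC1 hS₀ hN₁ hN₂ hKNw hepsN hG hη in
/-- **END TO END, keyed on the printed constants (MODEL).**  Centre `Ω̄ = ∫₀Ω̄₁` odd with `Ω̄₁ ∈ C¹`, finite weights, `|HΩ̄| ≤ H₀`,
`|Ω̄(X₀)| > (√2/8)·rE`; the pointwise (C1) datum; `S₀` the solution operator of `B_λ` (exists and is unique under (C1),
`exists_solutionOperator_of_pointwise`); (C2)/(C3) as the finite-rank data `(f, ℓ, N)` with `‖T_N∘S₀‖_{w→E} ≤ KNw` and `‖P − Π_N‖_{E→w} ≤ epsN`;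
residual `(∫ w G(Ω̄)²)^{1/2} ≤ eta`.  THEN there is exactly one `δ` in the closed `E`-ball of radius `rE` whose profile solves the linearised weak
equation `linForm(δ'; v) = ∫ w·(Pδ' − G(Ω̄) − Qδ'δ')·v` on compactly supported tests; `Ω* := Ω̄ + prim (der δ)` is `C²`; and for every `T > 0`
the exact self-similar function `(T − t)⁻¹Ω*(x/√(T − t))` is a classical solution of `ω_t + (1/5)uω_x = u_xω + ω_xx` on `ℝ × [0,T)` whose sup
norm blows up at `T`.  1-D MODEL statement; the numeric hypotheses are the certificate's interval arithmetic; NOT Navier–Stokes. [folklore] -/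
theorem modelBlowup_of_woodbury_certificate {X₀ : ℝ} (hX₀ : Real.sqrt 2 / 8 * (rE : ℝ) < |Ω X₀|) {T : ℝ} (hT : 0 < T) :
    ∃ δ ∈ closedBall (0 : Esp 8 eight_pos) (rE : ℝ),
      (∀ δ' ∈ closedBall (0 : Esp 8 eight_pos) (rE : ℝ),
        (∀ v v₁ : ℝ → ℝ, IsCompactTest v v₁ →
          linForm 8 (drift (1 / 5) Ω) (potential 8 4 Ω) (prim (der δ')) (der δ') v v₁ =
            ∫ y, ((8:ℝ) ^ 2 + y ^ 2) * ((PopFun 8 4 (1 / 5) Ω Ω₁ δ' y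
              - (Ω y + 1 / 2 * y * Ω₁ y + 1 / 5 * (∫ s in (0 : ℝ)..y, hilbertTransform Ω s) * Ω₁ y - hilbertTransform Ω y * Ω y - deriv Ω₁ y)
              - QFun 8 (1 / 5) δ' δ' y) * v y)) ↔ δ' = δ) ∧
      ContDiff ℝ 2 (fun y => Ω y + prim (der δ) y) ∧
      IsGCLMLineSolution (1 / 5) 1 (gclmSelfSimilar (-1) (1 / 2) T (fun y => Ω y + prim (der δ) y)) T ∧
      SupNormBlowupBefore (gclmSelfSimilar (-1) (1 / 2) T (fun y => Ω y + prim (der δ) y)) T := by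
  obtain ⟨M, hM₁, hM₂, hK⟩ := exists_inverse_of_woodbury hc S₀ f ℓ Nmat hN₁ hN₂ hKNw hepsN
  -- existence, `C²`, blow-up (right inverse + bound suffice)
  obtain ⟨δ, hball, hiff, hC2, hsol, hblow⟩ := modelBlowup_of_pointwise_certificate hc hΩ₁ S₀ hS₀ M hM₁ hK hG hη hX₀ hT
  -- uniqueness among weak solutions (needs the left inverse and (C1))
  obtain ⟨δu, hballu, hiffu⟩ := existsUnique_weakSolution_of_pointwise hc hΩ₁ hC1 S₀ hS₀ M hM₁ hK hG hη hM₂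
  -- the fixed point `δ` solves the weak equation, hence `δ = δu`
  obtain ⟨hGc, -⟩ := residual_of_contDiff eight_pos (1 / 5) hc hΩ₁
  have hg₀ae := (norm_toLp_W eight_pos (memLp_W (L := 8) hGc.aestronglyMeasurable hG)).1
  have hfix := (hiff δ hball).2 rfl
  have hweak : ∀ v v₁ : ℝ → ℝ, IsCompactTest v v₁ →
      linForm 8 (drift (1 / 5) Ω) (potential 8 4 Ω) (prim (der δ)) (der δ) v v₁ =
        ∫ y, ((8:ℝ) ^ 2 + y ^ 2) * ((PopFun 8 4 (1 / 5) Ω Ω₁ δ y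
          - (Ω y + 1 / 2 * y * Ω₁ y + 1 / 5 * (∫ s in (0 : ℝ)..y, hilbertTransform Ω s) * Ω₁ y - hilbertTransform Ω y * Ω y - deriv Ω₁ y)
          - QFun 8 (1 / 5) δ δ y) * v y) :=
    fun v v₁ hv => linearised_weak_eq_of_fixedPoint hc S₀ hS₀ M hM₁ _ hg₀ae hfix hv
  have hδu : δ = δu := (hiffu δ hball).1 hweak
  subst hδu
  exact ⟨δ, hball, hiffu, hC2, hsol, hblow⟩

end SheetRCertificateWoodbury
end Summit.NavierStokesRegularity.OSWSelfSimilar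

end
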